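import Mathlib
import Summits.ResolutionOfSingularities.ResolutionOfSingularities.Theorems.HomologicalConductorNoZenoSurfaceCore
import Summits.ResolutionOfSingularities.ResolutionOfSingularities.Theorems.HomologicalConductorNoZenoSurfaceLU
import Summits.ResolutionOfSingularities.ResolutionOfSingularities.Theorems.HomologicalConductorNoZenoExhaustionSandwich
import Summits.ResolutionOfSingularities.ResolutionOfSingularities.Theorems.HomologicalConductorNoZenoDominanceInvariance
import Summits.ResolutionOfSingularities.ResolutionOfSingularities.Theorems.HomologicalConductorNoZenoTowerNoetherian
import Summits.ResolutionOfSingularities.ResolutionOfSingularities.Theorems.HomologicalConductorNoZenoNoetherianCase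
import Summits.ResolutionOfSingularities.ResolutionOfSingularities.Theorems.NoZeno.Negative.SurfaceTowerDichotomy
import Summits.ResolutionOfSingularities.ResolutionOfSingularities.Theorems.HomologicalConductorPersistenceSurfaceTowerDim
import Literature.AlgebraicGeometry.Resolution.NormalSurfaceSingularLocus
import Summits.ResolutionOfSingularities.ResolutionOfSingularities.Theorems.HomologicalConductorSurfaceTerminationReductionDefs
import HarnessLib

/-!
# Route `HomologicalConductor`, support `SurfaceTermination` (stmt-ResolutionOfSingularities-16488):
# the DICHOTOMY REDUCTION — modulo the crux's six named facts, `SurfaceTermination` is EQUIVALENT to its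
# prime-divisor special case (D-s); and `StrictDrop ⇒ SurfaceTermination`

`[OURS · L W4.4]` Cell res-hironaka, crux chain W4.4 (planner res-L0-w44-plan-1: CHAIN v11 §2/§6, memo
`K44S-DESCENT` v1 §1, sketch `PrimeDivisorSketch.lean` 9e40d1426b49fe39 — whose (c2) proof is reproduced here over
the tree; prover res-L0-w44-stub-3).  Nothing here is a statement of the manuscript under review (Hironaka 2017);
AI-written, weaker than expert review.

Ingredients, all theorems of the tree: the UNCONDITIONAL surface tower dichotomy
`NoZeno.Negative.surfaceTower_dichotomy` (res-L0-w44-tri-1: for `tr.deg_k K ≤ 2` and ANY valuation ring `O ∋ k`,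
either the canonical normalised `ca`-tower exhausts `O`, or a PRIME DIVISOR `W` of `K/k` skeleton-dominates it),
dominance invariance `stub_dominanceInvariance` (p168418: then the `W`-tower IS the `O`-tower), local
uniformization in transcendence degree `≤ 2` from Cossart–Jannsen–Saito (`stub_surfaceLU_of_cossartJannsenSaito2020`,
p468911, fed by `CossartJannsenSaito2020General.cossartJannsenSaito2020_holds_of`), the exhaustion sandwich
`exh_exists_regular_le_tower_of_isLocallyUniformizable` (p463491: an exhausting tower eventually contains a regular
local `R ⊆ O` with `loc O R = R`), and the surface core `sandwichedTermination_of_facts` (p514642: a sandwiched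
tower reaches a regular stage along every valuation, modulo the six facts).

The Props are the NAMED ones of `…SurfaceTerminationReductionDefs.lean`: `PrimeDivisorSurfaceTermination` (D-s:
`SurfaceTermination` VERBATIM with its inline `let`-tower, restricted to `O` a prime divisor — K44S-DESCENT §1 text;
definitionally the named-tower form, `primeDivisorSurfaceTermination_iff_tower`) and `ExhaustiveSurfaceTermination`
(the planner's sketch text over the named tower).

* `exists_regular_of_exhausts_of_facts`, `exhaustiveSurfaceTermination_of_facts` (c1) — modulo the six facts,
  **exhaustive surface towers terminate** (`ExhaustiveSurfaceTermination`), for every valuation ring `O`.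
* `surfaceTermination_of_primeDivisorCase` (c2, FACT-FREE: `ExhaustiveSurfaceTermination →
  PrimeDivisorSurfaceTermination → SurfaceTermination`, the planner's sketch verbatim over the tree) and
  `surfaceTermination_iff_primeDivisorCase`; with (c1): `surfaceTermination_of_primeDivisorCase_of_facts`,
  **`surfaceTermination_iff_primeDivisorCase_of_facts (hF) : SurfaceTermination ↔ PrimeDivisorSurfaceTermination`**
  — modulo the six facts the kill test `SurfaceTermination` ⟺ (D-s) «along a prime divisor of the function field of
  a surface the canonical `ca`-tower of a two-dimensional affine model reaches a regular stage»; the composite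
  (rank-two) regime and every zero-dimensional valuation are absorbed by exhaustion + sandwich; (D-s) is the exact
  residual of K4.4-s and replaces «`StrictDrop` on surfaces».
* `primeDivisorSurfaceTermination_of_strictDrop`, **`surfaceTermination_of_strictDrop (hF) (hD : StrictDrop) :
  SurfaceTermination`** (c3) — along a prime divisor (a DVR, hence noetherian) the value drops of `StrictDrop`
  cannot go on for ever (`stub_noetherianCase`, p167613): the dimension-two truncation of the registered skeleton's
  `NoZenoR_of`, by name in the tree (without even `PersistenceRadical`).

The named facts (hF) are exactly the registered bundle `stub_publishedSurfaceFacts` of the crux `NoZenoR`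
(stmt-19943): Cossart–Jannsen–Saito 2020 Thm 1.2; Lipman 1969 (1.2), (4.1), (12.1)(i)/(ii); Görtz–Wedhorn II
Cor. 24.44 — `Literature` named facts, the route's fact debt.

References: O. Zariski, P. Samuel, *Commutative Algebra* II (1960), Ch. VI §10, §14 Thm. 31 [`ZariskiSamuel1960`];
S. Abhyankar, *On the valuations centered in a local domain*, Amer. J. Math. 78 (1956), Lemma 7
[`Abhyankar1956Valuations`]; M. Spivakovsky, Ann. of Math. 131 (1990), §II [`Spivakovsky1990`]; V. Cossart,
U. Jannsen, S. Saito, LNM 2270 (2020), Thm 1.2 [`CossartJannsenSaito2020`].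
-/

-- single-problem summit: the doubled namespace component `ResolutionOfSingularities` is forced
set_option linter.dupNamespace false

noncomputable section

open Summit.ResolutionOfSingularities.ResolutionOfSingularities.Theses.HomologicalConductor
open Summit.ResolutionOfSingularities.ResolutionOfSingularities.Theorems
open Summit.ResolutionOfSingularities.ResolutionOfSingularities.Theorems.NoZeno.Birth
open Summit.ResolutionOfSingularities.ResolutionOfSingularities.Theorems.NoZeno.SandwichCluster
open Literature.AlgebraicGeometry.Resolution

namespace Summit.ResolutionOfSingularities.ResolutionOfSingularities.Theorems.SurfaceTermination.Reduction


/-! ## (c1) Exhaustive surface towers terminate, modulo the facts -/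

/-- **(c1) An EXHAUSTING surface tower reaches a regular stage** (modulo the six facts): if `tr.deg_k K = 2` and
every element of `O` lies in some stage, then `O` is locally uniformizable over `k` (Cossart–Jannsen–Saito via
`stub_surfaceLU_of_cossartJannsenSaito2020`), so a regular local `R ⊆ O` with `Frac R = K`, `loc O R = R` lies in
every late stage (`exh_exists_regular_le_tower_of_isLocallyUniformizable`), and the sandwiched tower terminates
(`sandwichedTermination_of_facts`).  Any valuation ring `O`; no `Persistence`/`StrictDrop`.
[cite: CossartJannsenSaito2020, Thm. 1.2] [cite: Spivakovsky1990, §II] -/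
theorem exists_regular_of_exhausts_of_facts
    (hF : (Literature.AlgebraicGeometry.Resolution.CossartJannsenSaito2020General.{0} ∧
      Literature.AlgebraicGeometry.Resolution.Lipman1969_1_2.{0} ∧
      Literature.AlgebraicGeometry.Resolution.Lipman1969_4_1.{0} ∧
      Literature.AlgebraicGeometry.Resolution.Lipman1969_12_1_i.{0} ∧
      Literature.AlgebraicGeometry.Resolution.Lipman1969_12_1_ii.{0} ∧
      Literature.AlgebraicGeometry.Morphisms.GortzWedhorn2023_24_44_H2.{0}))
    (p : ℕ) (hp : p.Prime) (k K : Type) [Field k] [CharP k p] [Field K] [Algebra k K]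
    (O : ValuationSubring K) (A : Subalgebra k K) (hk : ∀ c : k, algebraMap k K c ∈ O) (hA : A.FG)
    (hfr : IsFractionRing ↥A K) (hAO : A.toSubring ≤ O.toSubring) (htr : Algebra.trdeg k K = 2)
    (hexh : ∀ x : K, x ∈ O → ∃ m : ℕ, x ∈ tower O A m) :
    ∃ m : ℕ, IsRegularLocalRing ↥(tower O A m) := by
  haveI := hfr
  haveI : Algebra.FiniteType k ↥A := A.fg_iff_finiteType.mp hA
  have hfg : (⊤ : IntermediateField k K).FG :=
    IntermediateField.fg_top_of_isFractionRing_of_finiteType k ↥A K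
  have hLU : IsLocallyUniformizable k K O :=
    stub_surfaceLU_of_cossartJannsenSaito2020
      (CossartJannsenSaito2020General.cossartJannsenSaito2020_holds_of hF.1) k K hfg htr.le O hk
  obtain ⟨R, hR, hRfr, hRO, hlocR, m₀, hm₀⟩ :=
    exh_exists_regular_le_tower_of_isLocallyUniformizable O A hk hAO hexh hLU
  exact sandwichedTermination_of_facts hF p hp k K O A R m₀ ⟨hk, hA, hfr, hAO, htr, hR, hRfr, hRO, hlocR, hm₀⟩

/-- **(c1) by name: `ExhaustiveSurfaceTermination` holds modulo the six facts.**
[cite: CossartJannsenSaito2020, Thm. 1.2] [cite: Spivakovsky1990, §II] -/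
theorem exhaustiveSurfaceTermination_of_facts
    (hF : (Literature.AlgebraicGeometry.Resolution.CossartJannsenSaito2020General.{0} ∧
      Literature.AlgebraicGeometry.Resolution.Lipman1969_1_2.{0} ∧
      Literature.AlgebraicGeometry.Resolution.Lipman1969_4_1.{0} ∧
      Literature.AlgebraicGeometry.Resolution.Lipman1969_12_1_i.{0} ∧
      Literature.AlgebraicGeometry.Resolution.Lipman1969_12_1_ii.{0} ∧
      Literature.AlgebraicGeometry.Morphisms.GortzWedhorn2023_24_44_H2.{0})) :
    ExhaustiveSurfaceTermination :=
  fun p hp k K _ _ _ _ O A hk hA hfr hAO htr hexh =>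
    exists_regular_of_exhausts_of_facts hF p hp k K O A hk hA hfr hAO htr hexh

/-! ## (c2) `SurfaceTermination` ⟺ its prime-divisor case -/

/-- The trivial direction: `SurfaceTermination` implies its prime-divisor special case (drop the three extra
hypotheses; the route's inline `let`-tower is definitionally the named tower). [this work] -/
theorem primeDivisorSurfaceTermination_of_surfaceTermination (h : SurfaceTermination) :
    PrimeDivisorSurfaceTermination := by
  intro p hp k K _ _ _ _ O A hk hA hfr hAO hdim _ _ _
  exact h p hp k K O A hk hA hfr hAO hdim

/-- An affine domain of Krull dimension `2` has a fraction field of transcendence degree `2` over `k`.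
[cite: Matsumura1987, Thm. 5.6] -/
theorem trdeg_eq_two_of_ringKrullDim_eq_two {k K : Type} [Field k] [Field K] [Algebra k K]
    (A : Subalgebra k K) (hA : A.FG) (hfr : IsFractionRing ↥A K) (hdim : ringKrullDim ↥A = 2) :
    Algebra.trdeg k K = 2 := by
  haveI : IsFractionRing ↥A K := hfr
  exact HomologicalConductor.PersistenceSurfaceTowerDim.trdeg_eq_of_ringKrullDim_eq A hA (d := 2)
    (by exact_mod_cast hdim)

/-- **(c2) The DICHOTOMY REDUCTION (fact-free form; the planner's sketch over the tree).**  Modulo «exhaustive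
surface towers terminate», `SurfaceTermination` follows from its prime-divisor case: for a datum `(O, A)` with
`dim A = 2` (so `tr.deg_k K = 2`), by the unconditional surface tower dichotomy (`NoZeno.Negative.surfaceTower_dichotomy`)
either the tower exhausts `O`, or a prime divisor `W ∋ k` of `K` (`W ≠ K`, a DVR, `residueTrdeg W + 1 = tr.deg`)
skeleton-dominates the tower; then every stage is noetherian (`stub_towerNoetherian`), the `W`-tower IS the
`O`-tower (`stub_dominanceInvariance`), `A ⊆ W` (`tn_tower_invariant`), and (D-s) at the datum `(W, A)` gives the
regular stage. [cite: Abhyankar1956Valuations, Lemma 7] [cite: ZariskiSamuel1960, Ch. VI §14, Thm. 31] -/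
theorem surfaceTermination_of_primeDivisorCase (hExh : ExhaustiveSurfaceTermination)
    (hDs : PrimeDivisorSurfaceTermination) : SurfaceTermination := by
  intro p hp k K _ _ _ _ O A hk hA hfr hAO hdim
  show ∃ m : ℕ, IsRegularLocalRing ↥(tower O A m)
  have htr : Algebra.trdeg k K = 2 := trdeg_eq_two_of_ringKrullDim_eq_two A hA hfr hdim
  rcases NoZeno.Negative.surfaceTower_dichotomy O A hk hA hfr hAO htr.le with
    hexh | ⟨W, hkW, hWtop, hdvr, hres, hdom⟩
  · exact hExh p hp k K O A hk hA hfr hAO htr hexh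
  · have hN : ∀ m : ℕ, IsNoetherianRing ↥(tower O A m) := fun m =>
      stub_towerNoetherian k K O A hk hA hfr hAO m
    have hTeq : ∀ m : ℕ, tower W A m = tower O A m := fun m =>
      stub_dominanceInvariance k K O W A hk hAO hN hdom m
    have hAW : A.toSubring ≤ W.toSubring := fun a ha =>
      (hdom 0 a ((tn_tower_invariant O A hk hA hfr hAO 0).1 ha)).1
    obtain ⟨m, hm⟩ := hDs p hp k K W A hkW hA hfr hAW hdim hWtop hdvr hres
    -- `hm` is stated over the route's inline `let`-tower at `(W, A)`: definitionally `tower W A m`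
    have hm' : IsRegularLocalRing ↥(tower W A m) := hm
    rw [hTeq m] at hm'
    exact ⟨m, hm'⟩

/-- `SurfaceTermination ↔ PrimeDivisorSurfaceTermination` modulo «exhaustive surface towers terminate»
(fact-free form). [this work] -/
theorem surfaceTermination_iff_primeDivisorCase (hExh : ExhaustiveSurfaceTermination) :
    SurfaceTermination ↔ PrimeDivisorSurfaceTermination :=
  ⟨primeDivisorSurfaceTermination_of_surfaceTermination, surfaceTermination_of_primeDivisorCase hExh⟩

/-- **(c2) modulo the six facts: the prime-divisor case (D-s) implies `SurfaceTermination`.**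
[cite: ZariskiSamuel1960, Ch. VI §14, Thm. 31] -/
theorem surfaceTermination_of_primeDivisorCase_of_facts
    (hF : (Literature.AlgebraicGeometry.Resolution.CossartJannsenSaito2020General.{0} ∧
      Literature.AlgebraicGeometry.Resolution.Lipman1969_1_2.{0} ∧
      Literature.AlgebraicGeometry.Resolution.Lipman1969_4_1.{0} ∧
      Literature.AlgebraicGeometry.Resolution.Lipman1969_12_1_i.{0} ∧
      Literature.AlgebraicGeometry.Resolution.Lipman1969_12_1_ii.{0} ∧
      Literature.AlgebraicGeometry.Morphisms.GortzWedhorn2023_24_44_H2.{0}))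
    (hDs : PrimeDivisorSurfaceTermination) : SurfaceTermination :=
  surfaceTermination_of_primeDivisorCase (exhaustiveSurfaceTermination_of_facts hF) hDs

/-- **Modulo the six named facts, the kill test `SurfaceTermination` (stmt-16488) is EQUIVALENT to its
prime-divisor special case (D-s)** — the exact residual of K4.4-s: «along a prime divisor of the function field
of a surface, the canonical normalised `ca`-tower of a two-dimensional affine model reaches a regular stage».
[cite: ZariskiSamuel1960, Ch. VI §14, Thm. 31] -/
theorem surfaceTermination_iff_primeDivisorCase_of_facts
    (hF : (Literature.AlgebraicGeometry.Resolution.CossartJannsenSaito2020General.{0} ∧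
      Literature.AlgebraicGeometry.Resolution.Lipman1969_1_2.{0} ∧
      Literature.AlgebraicGeometry.Resolution.Lipman1969_4_1.{0} ∧
      Literature.AlgebraicGeometry.Resolution.Lipman1969_12_1_i.{0} ∧
      Literature.AlgebraicGeometry.Resolution.Lipman1969_12_1_ii.{0} ∧
      Literature.AlgebraicGeometry.Morphisms.GortzWedhorn2023_24_44_H2.{0})) :
    SurfaceTermination ↔ PrimeDivisorSurfaceTermination :=
  surfaceTermination_iff_primeDivisorCase (exhaustiveSurfaceTermination_of_facts hF)

/-! ## (c3) `StrictDrop ⇒ SurfaceTermination`, modulo the facts -/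

/-- **`StrictDrop` settles the prime-divisor case** (fact-free): along a prime divisor `O` (a DVR, hence
noetherian) the value drops of `StrictDrop` cannot go on for ever — the landed order skeleton
`stub_noetherianCase` (p167613; ascending chain of principal ideals of `O`). [cite: ZariskiSamuel1960, Ch. VI §10] -/
theorem primeDivisorSurfaceTermination_of_strictDrop (hD : StrictDrop) : PrimeDivisorSurfaceTermination := by
  intro p hp k K _ _ _ _ O A hk hA hfr hAO _ _ hdvr _
  haveI := hdvr
  exact stub_noetherianCase hD p hp k K O A hk hA hfr hAO inferInstance

/-- **(c3) `StrictDrop → SurfaceTermination` modulo the six facts** — the dimension-two truncation of the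
registered skeleton's composition `NoZenoR_of` as a tree theorem: by (c2) only the prime-divisor case is left, and
there `StrictDrop` terminates the tower (`primeDivisorSurfaceTermination_of_strictDrop`).  `PersistenceRadical` is
not needed. [cite: ZariskiSamuel1960, Ch. VI §10] -/
theorem surfaceTermination_of_strictDrop
    (hF : (Literature.AlgebraicGeometry.Resolution.CossartJannsenSaito2020General.{0} ∧
      Literature.AlgebraicGeometry.Resolution.Lipman1969_1_2.{0} ∧
      Literature.AlgebraicGeometry.Resolution.Lipman1969_4_1.{0} ∧
      Literature.AlgebraicGeometry.Resolution.Lipman1969_12_1_i.{0} ∧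
      Literature.AlgebraicGeometry.Resolution.Lipman1969_12_1_ii.{0} ∧
      Literature.AlgebraicGeometry.Morphisms.GortzWedhorn2023_24_44_H2.{0}))
    (hD : StrictDrop) : SurfaceTermination :=
  surfaceTermination_of_primeDivisorCase_of_facts hF (primeDivisorSurfaceTermination_of_strictDrop hD)

end Summit.ResolutionOfSingularities.ResolutionOfSingularities.Theorems.SurfaceTermination.Reduction

end
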